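import Literature.NumberTheory.EllipticCurves.SemilinearTateDualPlaces
import Summits.BirchSwinnertonDyer.Rank1Residual.X11b.BDPRouteRelaxation
import HarnessLib

/-!
# Route `GenusKolyvaginAtTwo`, crux L_T `PowDvdShaCardAtTwoRT` (stmt-BirchSwinnertonDyer-23242), LINE 18 stub KS, the DROPS, input `hrec` —
# `inv_v(· ∪ₑ ·)` IS INVARIANT UNDER `σ_*` (the displayed hypotheses `hσ`, `hσb` of `…RTLocalEigenDuality`, discharged)

Seat `bsd-line-gk2-p3` g23 (PROVER seat 3/3, cell `bsd-f1-sign2`), `--supports stmt-BirchSwinnertonDyer-23242` (helper; closes nothing).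
THEOREMS ONLY (no definition, no named fact, no `sorry`).  BSD is NOT proved by any of this; neither is the crux nor any stub.

WHY.  `…RTLocalEigenDuality` (this seat) turns a displayed `τ`-structure on `H¹(K_v, E[2^M])` into the exact order of the two surviving
terms of Kolyvagin's two-term reciprocity (Math. Ann. 291 (1991) Thm. 2.1 = input `hrec` of `PlusDescent.weakSwapOracle_of_twoPrimeReciprocity`).
Its first two hypotheses are an involution `σ` of `H¹(K_v, E[n])` with `inv_v(σX ∪ₑ σY) = inv_v(X ∪ₑ Y)`.  THIS FILE discharges them
for `σ := conjActPlace W c n h` (the tree's `σ_*` on local cohomology, `SelmerGaloisActionPlaces`) at a place `v` with `c • v = v` (an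
INERT place of the Heegner field for `c` = complex conjugation), for every family of invariant maps COMPATIBLE with the Galois transport
of completions (`LocalInvariants.IsConjCompatible`; THE canonical family is: `isConjCompatible_canonical`) and every `Γ_K`-equivariant
biadditive `μₙ`-valued `e` on `E[n]` that is SEMILINEAR for the adapted lift (`e(tS, tT) = t(e(S, T))`, `t = liftAutPlace c h`; for the
Weil pairing of `E/ℚ` this is its `Aut(ℚ̄/ℚ)`-equivariance).
* `weilPairingHom_smul` — `Γ_K`-equivariance of `e` in the additive currency of `DiscreteGaloisModule.pairing`.
* **`invWeilPairing_conjActPlace`** — for ANY place datum `c • v = w`: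
  `inv_w(σ_* X ∪ₑ σ_* Y) = inv_v(X ∪ₑ Y)` (`semilinearLocalH_cupProduct` + `IsConjCompatible`).
* **`invWeilPairing_conjActPlace_self`** — at a `c`-fixed place (`c • v = v`): `σ_*` preserves `inv_v(· ∪ₑ ·)` — hypothesis `hσb`.
* `conjActPlace_conjActPlace_self` — `σ_* ∘ σ_* = id` there when `c² = 1` — hypothesis `hσ`.
* `conjActPlace_localization_self` — `σ_*(loc_v z) = loc_v(c_* z)`; `conjActPlace_localization_of_eigen` — `c_* z = ε z ⟹ σ_*(loc_v z) = ε loc_v z`.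

References: [CasselsFrohlichANT1967] Ch. VI §1.1, Ch. VII §1.1; [Jetchev2008] §5 Thm. 5.1; [MilneADT2006] I Cor. 2.3; [Kolyvagin1991MathAnn] Thm. 2.1.
-/

set_option autoImplicit false

noncomputable section

open scoped Classical

open CategoryTheory Field NumberField IsDedekindDomain Function WeierstrassCurve
open Literature.NumberTheory.Automorphic
open Literature.NumberTheory.EllipticCurves
open Literature.NumberTheory.GaloisRepresentations
open Literature.NumberTheory.GaloisCohomology
open Literature.NumberTheory.GaloisRepresentations.DiscreteGaloisModule (mu MuCarrier)
open Summit.BirchSwinnertonDyer.Rank1Residual.X11b.Relaxation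
open scoped ContRepresentation

-- the Theorems namespace of this sub repeats the summit name by design (D-0017 nested layout)
set_option linter.dupNamespace false

namespace Summit.BirchSwinnertonDyer.BirchSwinnertonDyer.Theorems.GenusExact.PlusDescent

universe u

variable {K : Type u} [Field K] [NumberField K] (W : WeierstrassCurve ℚ) (c : K ≃ₐ[ℚ] K)
variable (n : ℕ) [NeZero n]
variable (e : (W.baseChange K).geomTorsion ((n : ℕ) : ℤ) → (W.baseChange K).geomTorsion ((n : ℕ) : ℤ) → AlgebraicClosure K)
  (hμ : ∀ S T, e S T ^ n = 1)
  (hadd₁ : ∀ S₁ S₂ T, e (S₁ + S₂) T = e S₁ T * e S₂ T)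
  (hadd₂ : ∀ S T₁ T₂, e S (T₁ + T₂) = e S T₁ * e S T₂)
  (hgal : ∀ (γ : absoluteGaloisGroup K) (S T : (W.baseChange K).geomTorsion ((n : ℕ) : ℤ)), γ • e S T = e (γ • S) (γ • T))

include hgal in
/-- `Γ_K`-equivariance of `e` in the currency of `DiscreteGaloisModule.pairing`: `e(γS, γT) = γ·e(S, T)` additively on `μₙ`. [folklore] -/
theorem weilPairingHom_smul (γ : absoluteGaloisGroup K) (S T : (W.baseChange K).geomTorsion ((n : ℕ) : ℤ)) :
    weilPairingHom (W.baseChange K) n e hμ hadd₁ hadd₂ (((W.baseChange K).torsionGaloisModule ((n : ℕ) : ℤ)) γ S)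
        (((W.baseChange K).torsionGaloisModule ((n : ℕ) : ℤ)) γ T) =
      mu K n γ (weilPairingHom (W.baseChange K) n e hμ hadd₁ hadd₂ S T) := by
  apply MuCarrier.eq_of_coe_eq
  rw [coe_mu_apply, coe_weilPairingHom, torsionGaloisModule_apply_apply, torsionGaloisModule_apply_apply, coe_weilPairingHom]
  exact (hgal γ S T).symm

include hgal in
/-- **`inv_w(σ_* X ∪ₑ σ_* Y) = inv_v(X ∪ₑ Y)`** for every place datum `c • v = w`, every family `inv` compatible with the Galois transport
of completions, and every `e` semilinear for the adapted lift `t = liftAutPlace c h` (`e(tS, tT) = t(e(S,T))`): the local Weil cup-product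
pairing is transported by `σ_* = conjActPlace` (`semilinearLocalH_cupProduct`) and THE invariant maps see through the transport
(`IsConjCompatible`). [cite: CasselsFrohlichANT1967, Ch. VI §1.1] [cite: Jetchev2008, §5 Thm. 5.1] -/
theorem invWeilPairing_conjActPlace {v w : HeightOneSpectrum (𝓞 K)} (h : c • v = w)
    (hte : ∀ S T, e ((isLiftOfAut_liftAutPlace c h).torsionMap W ((n : ℕ) : ℤ) S)
      ((isLiftOfAut_liftAutPlace c h).torsionMap W ((n : ℕ) : ℤ) T) = liftAutPlace c h (e S T))
    (inv : LocalInvariants K n) (hinv : inv.IsConjCompatible c)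
    (X Y : galoisCohomology (((W.baseChange K).torsionGaloisModule ((n : ℕ) : ℤ)).toLocal (Sum.inr v : Place K)) 1) :
    invWeilPairing (W.baseChange K) n e hμ hadd₁ hadd₂ hgal inv (Sum.inr w) (conjActPlace W c ((n : ℕ) : ℤ) h X)
        (conjActPlace W c ((n : ℕ) : ℤ) h Y) =
      invWeilPairing (W.baseChange K) n e hμ hadd₁ hadd₂ hgal inv (Sum.inr v) X Y := by
  haveI : CompactSpace (absoluteGaloisGroup (v.adicCompletion K)) := absoluteGaloisGroup_compactSpace _
  haveI : CompactSpace (absoluteGaloisGroup (w.adicCompletion K)) := absoluteGaloisGroup_compactSpace _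
  have hBψ : ∀ S T, weilPairingHom (W.baseChange K) n e hμ hadd₁ hadd₂
      ((isLiftOfAut_liftAutPlace c h).torsionMap W ((n : ℕ) : ℤ) S) ((isLiftOfAut_liftAutPlace c h).torsionMap W ((n : ℕ) : ℤ) T) =
      muSemilinearMap (liftAutPlace c h) n (weilPairingHom (W.baseChange K) n e hμ hadd₁ hadd₂ S T) := fun S T ↦ by
    apply MuCarrier.eq_of_coe_eq
    rw [coe_muSemilinearMap, coe_weilPairingHom, coe_weilPairingHom]
    exact hte S T
  have key := semilinearLocalH_cupProduct (ρ := (W.baseChange K).torsionGaloisModule ((n : ℕ) : ℤ))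
    (ρN := (W.baseChange K).torsionGaloisModule ((n : ℕ) : ℤ)) (ρP := mu K n)
    (E := v.adicCompletion K) (E' := w.adicCompletion K) (isLiftOfAut_liftAutPlace c h)
    (isLiftOfRingEquiv_ringEquivLift (galAdicCompletionEquiv (L := K) c h))
    (liftsCommute_liftAutPlace c h) (weilPairingHom (W.baseChange K) n e hμ hadd₁ hadd₂)
    (weilPairingHom_smul W n e hμ hadd₁ hadd₂ hgal)
    ((isLiftOfAut_liftAutPlace c h).torsionMap W ((n : ℕ) : ℤ)) ((isLiftOfAut_liftAutPlace c h).torsionMap_smul W ((n : ℕ) : ℤ))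
    ((isLiftOfAut_liftAutPlace c h).torsionMap W ((n : ℕ) : ℤ)) ((isLiftOfAut_liftAutPlace c h).torsionMap_smul W ((n : ℕ) : ℤ))
    (muSemilinearMap (liftAutPlace c h) n) (isSemilinear_mu (isLiftOfAut_liftAutPlace c h) n) hBψ X Y
  rw [invWeilPairing_apply, invWeilPairing_apply, ← hinv v w h]
  exact congrArg (inv (Sum.inr w)) key.symm

include hgal in
/-- **Hypothesis `hσb` of `…RTLocalEigenDuality`, discharged**: at a `c`-FIXED place (`c • v = v`; an inert place of the Heegner field for
the complex conjugation `c`), `σ_* = conjActPlace W c n h` preserves `inv_v(· ∪ₑ ·)`. [cite: CasselsFrohlichANT1967, Ch. VI §1.1]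
[cite: Kolyvagin1991MathAnn, Thm. 2.1] -/
theorem invWeilPairing_conjActPlace_self {v : HeightOneSpectrum (𝓞 K)} (h : c • v = v)
    (hte : ∀ S T, e ((isLiftOfAut_liftAutPlace c h).torsionMap W ((n : ℕ) : ℤ) S)
      ((isLiftOfAut_liftAutPlace c h).torsionMap W ((n : ℕ) : ℤ) T) = liftAutPlace c h (e S T))
    (inv : LocalInvariants K n) (hinv : inv.IsConjCompatible c)
    (X Y : galoisCohomology (((W.baseChange K).torsionGaloisModule ((n : ℕ) : ℤ)).toLocal (Sum.inr v : Place K)) 1) :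
    invWeilPairing (W.baseChange K) n e hμ hadd₁ hadd₂ hgal inv (Sum.inr v) (conjActPlace W c ((n : ℕ) : ℤ) h X)
        (conjActPlace W c ((n : ℕ) : ℤ) h Y) =
      invWeilPairing (W.baseChange K) n e hμ hadd₁ hadd₂ hgal inv (Sum.inr v) X Y :=
  invWeilPairing_conjActPlace W c n e hμ hadd₁ hadd₂ hgal h hte inv hinv X Y

omit [NeZero n] in
/-- **Hypothesis `hσ` of `…RTLocalEigenDuality`, discharged**: at a `c`-fixed place, `σ_* ∘ σ_* = id` when `c² = 1`.
[cite: SerreLocalFields1979, VII.§5 Prop. 3] -/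
theorem conjActPlace_conjActPlace_self (hc : c * c = 1) {v : HeightOneSpectrum (𝓞 K)} (h : c • v = v)
    (X : galoisCohomology (((W.baseChange K).torsionGaloisModule ((n : ℕ) : ℤ)).toLocal (Sum.inr v : Place K)) 1) :
    conjActPlace W c ((n : ℕ) : ℤ) h (conjActPlace W c ((n : ℕ) : ℤ) h X) = X :=
  conjActPlace_conjActPlace W c ((n : ℕ) : ℤ) hc h h X

omit [NeZero n] in
/-- At a `c`-fixed place: `σ_*(loc_v z) = loc_v(c_* z)` (`conjActPlace_localization` with `w = v`). [cite: Jetchev2008, §5 Thm. 5.1] -/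
theorem conjActPlace_localization_self {v : HeightOneSpectrum (𝓞 K)} (h : c • v = v)
    (z : galoisCohomology ((W.baseChange K).torsionGaloisModule ((n : ℕ) : ℤ)) 1) :
    conjActPlace W c ((n : ℕ) : ℤ) h
        (galoisCohomology.localization ((W.baseChange K).torsionGaloisModule ((n : ℕ) : ℤ)) (Sum.inr v : Place K) 1 z) =
      galoisCohomology.localization ((W.baseChange K).torsionGaloisModule ((n : ℕ) : ℤ)) (Sum.inr v : Place K) 1
        (conjAct W c ((n : ℕ) : ℤ) z) :=
  conjActPlace_localization W c ((n : ℕ) : ℤ) h z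

omit [NeZero n] in
/-- **Localisations of `c`-eigenclasses are `σ_*`-eigenclasses** at a `c`-fixed place: `c_* z = ε z` (`ε = ±1`) ⟹ `σ_*(loc_v z) = ε loc_v z` —
the eigen hypotheses of `…RTLocalEigenDuality` for the localisations of Kolyvagin's classes (whose `c`-signs are
`sign_conjAct_kolyvaginClass_two`). [cite: Jetchev2008, §5 Thm. 5.1] [cite: GrossLMS1991, §5 (5.1)] -/
theorem conjActPlace_localization_of_eigen {v : HeightOneSpectrum (𝓞 K)} (h : c • v = v) {ε : ℤ} (hε : ε = 1 ∨ ε = -1)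
    {z : galoisCohomology ((W.baseChange K).torsionGaloisModule ((n : ℕ) : ℤ)) 1} (hz : conjAct W c ((n : ℕ) : ℤ) z = ε • z) :
    conjActPlace W c ((n : ℕ) : ℤ) h
        (galoisCohomology.localization ((W.baseChange K).torsionGaloisModule ((n : ℕ) : ℤ)) (Sum.inr v : Place K) 1 z) =
      ε • galoisCohomology.localization ((W.baseChange K).torsionGaloisModule ((n : ℕ) : ℤ)) (Sum.inr v : Place K) 1 z := by
  rcases hε with rfl | rfl
  · rw [one_zsmul] at hz
    rw [one_zsmul, conjActPlace_localization_self W c n h z, hz]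
  · rw [neg_one_zsmul] at hz
    rw [neg_one_zsmul, conjActPlace_localization_self W c n h z, hz, map_neg]

end Summit.BirchSwinnertonDyer.BirchSwinnertonDyer.Theorems.GenusExact.PlusDescent

end
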